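import Mathlib
import HarnessLib
import Summits.ResolutionOfSingularities.ResolutionOfSingularities.Theorems.HomologicalConductorNoZenoStableAnnihilatorReduction

set_option linter.dupNamespace false

/-!
# Modules stably annihilated by a power of every element of the maximal ideal

`[OURS · L w44b · completion model, ascent half · res-type-015 gen 15]` — third brick towards the
discharge of the named fact `Literature.RingTheory.CohomologyAnnihilator.le_caCompletion_comap`
([BahlekehHakimianSalarianTakahashi2015, Thm. 4.5 (2)]), helper for the surface rung
`PersistenceSurface` (stmt-ResolutionOfSingularities-19970) of crux chain w44b.  NOT a statement of
the manuscript under adjudication in cell res-hironaka; pure commutative algebra over Mathlib and the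
tree's `StablyAnnihilates` (crux-chain W4.4 CA-layer, `…NoZenoStableAnnihilatorReduction`).

For a noetherian local ring `(S, 𝔫)` we work with finitely generated modules `M` that are
**punctured-free** in the operative sense
`∀ y ∈ 𝔫, ∃ e, StablyAnnihilates S (y ^ e) M` («`y^e • 𝟙 M` factors through a finitely generated
projective») — for `M` finitely generated this is the classical «locally free on the punctured
spectrum» (`Ext¹(M, ΩM)` of finite length), the class `mod₀ S` of [BHST15, §4]; no name is
introduced, the hypothesis is spelled out.  Bookkeeping for the induction of the sibling file
`…CompletionAscentRetract`:

* `stablyAnnihilates_quotient` — stable annihilation passes to `M/JM` over `S/J`;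
* `exists_pow_le_annihilator_of_associatedPrimes_subset` — a finitely generated module whose
  associated primes are all `= 𝔫` is killed by a power of `𝔫`;
* `exists_pow_forall_mul_eq_zero` — if `w` lies in no associated prime of `S` other than `𝔫`, then
  `(0 :_S w)` is killed by a power of `𝔫`;
* `exists_pow_forall_smul_eq_zero_of_torsion` — hence, for `M` punctured-free, `(0 :_M w)` is killed
  by a power of `𝔫` (embed a projective into a finite free module);
* `exists_mem_maximalIdeal_forall_notMem_associatedPrimes` — prime avoidance: for a local
  homomorphism `R → S` of local rings with `𝔪S = 𝔫` there is `x ∈ 𝔪` whose image lies in no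
  associated prime of `S` other than `𝔫`;
* `ringKrullDim_quotient_span_lt` — for such `w` (in no minimal prime), `dim S/(w) < dim S` when
  `dim S ≥ 1`; `exists_maximalIdeal_pow_eq_bot_of_ringKrullDim_eq_zero` — `dim S = 0 ⇒ 𝔫` nilpotent.

References: A. Bahlekeh, E. Hakimian, S. Salarian, R. Takahashi, arXiv:1504.06163, §4
[`BahlekehHakimianSalarianTakahashi2015`]; S. B. Iyengar, R. Takahashi, arXiv:1404.1476, Remark 2.12
[`IyengarTakahashi2014`].
-/

noncomputable section

open CategoryTheory IsLocalRing Literature.RingTheory.CohomologyAnnihilator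
open Summit.ResolutionOfSingularities.ResolutionOfSingularities.Theorems.NoZeno.SandwichCluster
open scoped Pointwise TensorProduct

universe u

namespace Summit.ResolutionOfSingularities.ResolutionOfSingularities.Theorems.HomologicalConductor.CompletionAscentPunctured

variable {S : Type u} [CommRing S]

/-! ## Stable annihilation modulo an ideal -/

/-- An `S`-linear map induces an `S/J`-linear map `M/JM → P/JP`. [folklore] -/
theorem exists_hom_quotient (J : Ideal S) {M P : Type u} [AddCommGroup M] [Module S M]
    [AddCommGroup P] [Module S P] (f : M →ₗ[S] P) :
    ∃ fq : ModuleCat.of (S ⧸ J) (M ⧸ (J • ⊤ : Submodule S M)) ⟶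
        ModuleCat.of (S ⧸ J) (P ⧸ (J • ⊤ : Submodule S P)),
      ∀ m : M, fq (Submodule.Quotient.mk m) = Submodule.Quotient.mk (f m) := by
  have h : (J • ⊤ : Submodule S M) ≤ (J • ⊤ : Submodule S P).comap f := by
    rw [← Submodule.map_le_iff_le_comap, Submodule.map_smul'']
    exact Submodule.smul_mono le_rfl le_top
  exact ⟨ModuleCat.ofHom (LinearMap.extendScalarsOfSurjective Ideal.Quotient.mk_surjective
    ((J • ⊤ : Submodule S M).mapQ (J • ⊤ : Submodule S P) f h)), fun m => rfl⟩

/-- For `P` finitely generated projective over `S`, `P/JP` is finitely generated projective over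
`S/J` (`(S/J) ⊗_S P ≅ P/JP`). [folklore] -/
theorem projective_quotient (J : Ideal S) (P : ModuleCat.{u} S) [Module.Finite S P]
    (hP : Projective P) :
    Projective (ModuleCat.of (S ⧸ J) (P ⧸ (J • ⊤ : Submodule S P))) := by
  haveI := moduleProjective_of_projective P hP
  haveI : Module.Projective (S ⧸ J) ((S ⧸ J) ⊗[S] P) := inferInstance
  let e : ((S ⧸ J) ⊗[S] P) ≃ₗ[S ⧸ J] (P ⧸ (J • ⊤ : Submodule S P)) :=
    (TensorProduct.quotTensorEquivQuotSMul P J).extendScalarsOfSurjective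
      Ideal.Quotient.mk_surjective
  haveI := Module.Projective.of_equiv e
  exact (IsProjective.iff_projective (R := S ⧸ J) (P ⧸ (J • ⊤ : Submodule S P))).mp inferInstance

/-- **Stable annihilation passes to the quotient modulo an ideal**: if `c • 𝟙 M` factors through a
finitely generated projective `S`-module, then `c̄ • 𝟙 (M/JM)` factors through a finitely generated
projective `S/J`-module (reduce the factorisation). [folklore] -/
theorem stablyAnnihilates_quotient (J : Ideal S) {c : S} {M : ModuleCat.{u} S}
    (h : StablyAnnihilates S c M) :
    StablyAnnihilates (S ⧸ J) (Ideal.Quotient.mk J c)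
      (ModuleCat.of (S ⧸ J) (M ⧸ (J • ⊤ : Submodule S M))) := by
  obtain ⟨P, hPfin, hPproj, ι, π, hιπ⟩ := h
  haveI := hPfin
  obtain ⟨ιq, hιq⟩ := exists_hom_quotient J ι.hom
  obtain ⟨πq, hπq⟩ := exists_hom_quotient J π.hom
  refine ⟨ModuleCat.of (S ⧸ J) (P ⧸ (J • ⊤ : Submodule S P)),
    Module.Finite.of_restrictScalars_finite S _ _, projective_quotient J P hPproj, ιq, πq, ?_⟩
  apply ModuleCat.hom_ext
  refine LinearMap.ext fun z => ?_
  induction z using Submodule.Quotient.induction_on with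
  | _ m =>
    have hm : π.hom (ι.hom m) = c • m := apply_apply_eq_smul_of_comp_eq_smul_id hιπ m
    change πq (ιq (Submodule.Quotient.mk m)) =
      (Ideal.Quotient.mk J c) • (Submodule.Quotient.mk m : M ⧸ (J • ⊤ : Submodule S M))
    rw [hιq, hπq, hm]
    rfl

/-- Punctured-freeness passes to `M/JM` over `S/J` (`S` local, `J ≠ ⊤`): every `ȳ ∈ 𝔫̄` lifts to
`y ∈ 𝔫`. [folklore] -/
theorem puncturedFree_quotient [IsLocalRing S] (J : Ideal S) [IsLocalRing (S ⧸ J)]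
    {M : ModuleCat.{u} S} (hM : ∀ y ∈ maximalIdeal S, ∃ e : ℕ, StablyAnnihilates S (y ^ e) M) :
    ∀ y ∈ maximalIdeal (S ⧸ J), ∃ e : ℕ,
      StablyAnnihilates (S ⧸ J) (y ^ e) (ModuleCat.of (S ⧸ J) (M ⧸ (J • ⊤ : Submodule S M))) := by
  intro y hy
  obtain ⟨y, rfl⟩ := Ideal.Quotient.mk_surjective y
  have hy' : y ∈ maximalIdeal S := by
    rw [IsLocalRing.mem_maximalIdeal, mem_nonunits_iff] at hy ⊢
    exact fun hu => hy (hu.map _)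
  obtain ⟨e, he⟩ := hM y hy'
  exact ⟨e, by rw [← map_pow]; exact stablyAnnihilates_quotient J he⟩

/-! ## Modules with associated primes inside `{𝔫}` -/

/-- A finitely generated module over a noetherian local ring all of whose associated primes are the
maximal ideal is killed by a power of the maximal ideal (the minimal primes of its annihilator are
associated). [folklore] -/
theorem exists_pow_le_annihilator_of_associatedPrimes_subset [IsNoetherianRing S] [IsLocalRing S]
    {T : Type u} [AddCommGroup T] [Module S T] [Module.Finite S T]
    (h : associatedPrimes S T ⊆ {maximalIdeal S}) :
    ∃ k : ℕ, maximalIdeal S ^ k ≤ Module.annihilator S T := by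
  by_cases hT : Module.annihilator S T = ⊤
  · exact ⟨0, by rw [hT]; exact le_top⟩
  refine Ideal.exists_pow_le_of_le_radical_of_fg ?_ (maximalIdeal S).fg_of_isNoetherianRing
  rw [Ideal.radical_eq_sInf]
  refine le_sInf ?_
  rintro p ⟨hp, hpprime⟩
  obtain ⟨q, hq, hqp⟩ := Ideal.exists_minimalPrimes_le hp
  have hq' := Module.associatedPrimes.minimalPrimes_annihilator_subset_associatedPrimes S T hq
  rw [h hq'] at hqp
  exact hqp

/-- If `w` lies in no associated prime of `S` other than `𝔫` (`S` noetherian local), then the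
annihilator `(0 :_S w)` is killed by a power of `𝔫`: its associated primes are associated primes of
`S` containing `w`. [folklore] -/
theorem exists_pow_forall_mul_eq_zero [IsNoetherianRing S] [IsLocalRing S] {w : S}
    (hw : ∀ P ∈ associatedPrimes S S, P ≠ maximalIdeal S → w ∉ P) :
    ∃ k : ℕ, ∀ z ∈ maximalIdeal S ^ k, ∀ s : S, w * s = 0 → z * s = 0 := by
  let T := Submodule.torsionBy S S w
  have hT : associatedPrimes S T ⊆ {maximalIdeal S} := by
    intro P hP
    have hPS : P ∈ associatedPrimes S S := associatedPrimes.subset_of_injective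
      (f := T.subtype) Subtype.val_injective hP
    obtain ⟨hPprime, x, hx⟩ := hP
    have hwP : w ∈ P := by
      rw [hx]
      refine Ideal.le_radical ?_
      rw [Submodule.mem_colon_singleton, Submodule.mem_bot]
      exact Subtype.ext ((Submodule.mem_torsionBy_iff w (x : S)).mp x.2)
    by_contra hne
    exact hw P hPS hne hwP
  obtain ⟨k, hk⟩ := exists_pow_le_annihilator_of_associatedPrimes_subset hT
  refine ⟨k, fun z hz s hs => ?_⟩
  have hs' : s ∈ T := (Submodule.mem_torsionBy_iff w s).mpr (by rw [smul_eq_mul, hs])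
  have := Module.mem_annihilator.mp (hk hz) ⟨s, hs'⟩
  exact congrArg Subtype.val this

/-- **`(0 :_M w)` is killed by a power of `𝔫`** for `M` punctured-free over a noetherian local
`(S, 𝔫)` and `w` in no associated prime of `S` other than `𝔫`: if `yᵉ • 𝟙 M = π ∘ ι` through a
projective `P ⊆ Sⁿ`, then for `w m = 0` the coordinates of `ι m` lie in `(0 :_S w)`, which is
killed by `𝔫ᵏ`; so `y^{k+e} m = yᵏ π(ι m) = π(yᵏ ι m) = 0`, whence `𝔫 ⊆ √ann (0 :_M w)`.
[folklore] -/
theorem exists_pow_forall_smul_eq_zero_of_torsion [IsNoetherianRing S] [IsLocalRing S] {w : S}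
    (hw : ∀ P ∈ associatedPrimes S S, P ≠ maximalIdeal S → w ∉ P) {M : ModuleCat.{u} S}
    (hM : ∀ y ∈ maximalIdeal S, ∃ e : ℕ, StablyAnnihilates S (y ^ e) M) :
    ∃ k : ℕ, ∀ z ∈ maximalIdeal S ^ k, ∀ m : M, w • m = 0 → z • m = 0 := by
  obtain ⟨k₁, hk₁⟩ := exists_pow_forall_mul_eq_zero hw
  let A := Submodule.torsionBy S M w
  suffices hrad : maximalIdeal S ≤ (Module.annihilator S A).radical by
    obtain ⟨k, hk⟩ := Ideal.exists_pow_le_of_le_radical_of_fg hrad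
      (maximalIdeal S).fg_of_isNoetherianRing
    refine ⟨k, fun z hz m hm => ?_⟩
    have hm' : m ∈ A := (Submodule.mem_torsionBy_iff w m).mpr hm
    exact congrArg Subtype.val (Module.mem_annihilator.mp (hk hz) ⟨m, hm'⟩)
  intro y hy
  obtain ⟨e, P, hPfin, hPproj, ι, π, hιπ⟩ := hM y hy
  haveI := hPfin
  haveI := moduleProjective_of_projective P hPproj
  -- embed `P` into a finite free module
  obtain ⟨n, q, hq⟩ := Module.Finite.exists_fin' S P
  obtain ⟨j, hj⟩ := Module.projective_lifting_property q LinearMap.id hq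
  have hjinj : Function.Injective j := fun p₁ p₂ hp => by
    have := congrArg q hp
    rwa [← LinearMap.comp_apply, ← LinearMap.comp_apply, hj] at this
  refine ⟨k₁ + e, Module.mem_annihilator.mpr fun a => Subtype.ext ?_⟩
  have ha : w • (a : M) = 0 := (Submodule.mem_torsionBy_iff w (a : M)).mp a.2
  -- the coordinates of `ι a` are killed by `w`, hence by `y ^ k₁`
  have hcoord : (y ^ k₁) • ι.hom (a : M) = 0 := by
    apply hjinj
    rw [map_smul, map_zero]
    funext i
    rw [Pi.smul_apply, smul_eq_mul, Pi.zero_apply]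
    refine hk₁ _ (Ideal.pow_mem_pow hy k₁) _ ?_
    have h0 : j (ι.hom (w • (a : M))) = 0 := by rw [ha, map_zero, map_zero]
    rw [map_smul, map_smul] at h0
    simpa using congrFun h0 i
  change (y ^ (k₁ + e)) • (a : M) = ((0 : A) : M)
  rw [pow_add, mul_smul, ← apply_apply_eq_smul_of_comp_eq_smul_id hιπ (a : M), ← map_smul, hcoord,
    map_zero]
  rfl

/-! ## Choosing the element: prime avoidance from the base -/

/-- **Prime avoidance from the base.**  Let `R → S` be a homomorphism of local rings with
`𝔪S = 𝔫`, `S` noetherian.  Then some `x ∈ 𝔪` maps into no associated prime of `S` other than `𝔫`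
(the finitely many primes `𝔓 ∩ R`, `𝔓 ∈ Ass S ∖ {𝔫}`, are proper subideals… more precisely none
contains `𝔪`, since `𝔪 ⊆ 𝔓 ∩ R` forces `𝔫 = 𝔪S ⊆ 𝔓`). [folklore] -/
theorem exists_mem_maximalIdeal_forall_notMem_associatedPrimes {R : Type u} [CommRing R]
    [IsLocalRing R] [Algebra R S] [IsNoetherianRing S] [IsLocalRing S]
    (hmap : (maximalIdeal R).map (algebraMap R S) = maximalIdeal S) :
    ∃ x ∈ maximalIdeal R, ∀ P ∈ associatedPrimes S S, P ≠ maximalIdeal S → algebraMap R S x ∉ P := by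
  classical
  let F : Finset (Ideal S) := (associatedPrimes.finite S S).toFinset.filter (· ≠ maximalIdeal S)
  have hF : ∀ P, P ∈ F ↔ P ∈ associatedPrimes S S ∧ P ≠ maximalIdeal S := fun P => by
    simp only [F, Finset.mem_filter, Set.Finite.mem_toFinset]
  by_contra hcon
  push Not at hcon
  have hsub : ((maximalIdeal R : Set R)) ⊆ ⋃ P ∈ (↑F : Set (Ideal S)),
      ((P.comap (algebraMap R S) : Ideal R) : Set R) := by
    intro x hx
    obtain ⟨P, hP, hne, hxP⟩ := hcon x hx
    simp only [Set.mem_iUnion, Finset.mem_coe]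
    exact ⟨P, (hF P).mpr ⟨hP, hne⟩, hxP⟩
  have hprime : ∀ P ∈ F, P ≠ maximalIdeal S → P ≠ maximalIdeal S →
      (P.comap (algebraMap R S)).IsPrime := fun P hP _ _ => by
    haveI : P.IsPrime := IsAssociatedPrime.isPrime ((hF P).mp hP).1
    exact Ideal.comap_isPrime _ _
  obtain ⟨P, hP, hle⟩ := (Ideal.subset_union_prime (maximalIdeal S) (maximalIdeal S) hprime).mp hsub
  obtain ⟨hPass, hPne⟩ := (hF P).mp hP
  haveI : P.IsPrime := IsAssociatedPrime.isPrime hPass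
  have hle' : maximalIdeal S ≤ P := by
    rw [← hmap, Ideal.map_le_iff_le_comap]
    exact hle
  exact hPne ((IsLocalRing.maximalIdeal.isMaximal S).eq_of_le Ideal.IsPrime.ne_top' hle').symm

/-! ## Dimension -/

/-- The annihilator of a commutative ring as a module over itself is zero. [folklore] -/
theorem annihilator_self_eq_bot : Module.annihilator S S = ⊥ := by
  rw [eq_bot_iff]
  intro r hr
  have := Module.mem_annihilator.mp hr 1
  rw [smul_eq_mul, mul_one] at this
  exact this

/-- **Cutting down the dimension**: if `dim S = d ≥ 1` (`S` noetherian local) and `w` lies in no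
associated prime of `S` other than `𝔫`, then `w` lies in no minimal prime, so
`dim S/(w) + 1 ≤ dim S` (Mathlib's `Module.supportDim_quotSMulTop_succ_le_of_notMem_minimalPrimes`);
stated as the existence of `d' < d` with `dim S/J = d'` for any ideal `J = (w)`. [folklore] -/
theorem exists_ringKrullDim_quotient_lt [IsNoetherianRing S] [IsLocalRing S] {w : S}
    (hwm : w ∈ maximalIdeal S)
    (hw : ∀ P ∈ associatedPrimes S S, P ≠ maximalIdeal S → w ∉ P) {d : ℕ} (hd : 1 ≤ d)
    (hdim : ringKrullDim S = d) {J : Ideal S} (hJ : J = Ideal.span {w}) :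
    ∃ d' : ℕ, d' < d ∧ ringKrullDim (S ⧸ J) = d' := by
  -- `w` avoids the minimal primes
  have hmin : ∀ p ∈ (Module.annihilator S S).minimalPrimes, w ∉ p := by
    intro p hp
    have hpass := Module.associatedPrimes.minimalPrimes_annihilator_subset_associatedPrimes S S hp
    refine hw p hpass fun hpm => ?_
    rw [annihilator_self_eq_bot] at hp
    have h0 : (maximalIdeal S).height = 0 := Ideal.height_eq_zero_iff.mpr (hpm ▸ hp)
    have := IsLocalRing.maximalIdeal_height_eq_ringKrullDim (R := S)
    rw [h0, hdim] at this
    norm_cast at this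
    omega
  have hle := Module.supportDim_quotSMulTop_succ_le_of_notMem_minimalPrimes (M := S) hmin
  rw [Module.supportDim_self_eq_ringKrullDim, hdim] at hle
  -- `QuotSMulTop w S = S ⧸ w • ⊤` and `w • ⊤ = span {w} = J`
  have hJ' : J = w • (⊤ : Submodule S S) := by
    rw [hJ, ← Submodule.ideal_span_singleton_smul, smul_eq_mul, Ideal.mul_top]
  have hq : Module.supportDim S (QuotSMulTop w S) = ringKrullDim (S ⧸ J) := by
    rw [hJ']
    exact Module.supportDim_quotient_eq_ringKrullDim _
  rw [hq] at hle
  -- extract a natural number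
  haveI : Nontrivial (S ⧸ J) := by
    rw [Ideal.Quotient.nontrivial_iff, hJ, Ne, Ideal.span_singleton_eq_top]
    exact (IsLocalRing.mem_maximalIdeal w).mp hwm
  haveI := IsLocalRing.of_surjective' (Ideal.Quotient.mk J) Ideal.Quotient.mk_surjective
  have hfin : ((maximalIdeal (S ⧸ J)).height : WithBot ℕ∞) = ringKrullDim (S ⧸ J) :=
    IsLocalRing.maximalIdeal_height_eq_ringKrullDim
  have hne : (maximalIdeal (S ⧸ J)).height ≠ ⊤ := Ideal.height_ne_top (Ideal.IsPrime.ne_top')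
  obtain ⟨d', hd'⟩ := ENat.ne_top_iff_exists.mp hne
  refine ⟨d', ?_, by rw [← hfin, ← hd']; rfl⟩
  rw [← hfin, ← hd'] at hle
  have : ((d' : ℕ∞) : WithBot ℕ∞) + 1 ≤ (d : WithBot ℕ∞) := hle
  norm_cast at this

/-- A noetherian local ring of Krull dimension `0` has nilpotent maximal ideal (it is artinian).
[folklore] -/
theorem exists_maximalIdeal_pow_eq_bot_of_ringKrullDim_eq_zero [IsNoetherianRing S] [IsLocalRing S]
    (h0 : ringKrullDim S = 0) : ∃ k : ℕ, maximalIdeal S ^ k = ⊥ := by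
  haveI : Ring.KrullDimLE 0 S := Ring.krullDimLE_iff.mpr (by rw [h0]; rfl)
  haveI : IsArtinianRing S := isArtinianRing_iff_isNoetherianRing_krullDimLE_zero.mpr ⟨‹_›, ‹_›⟩
  obtain ⟨k, hk⟩ := (isArtinianRing_iff_isNilpotent_maximalIdeal S).mp ‹_›
  exact ⟨k, hk⟩

end Summit.ResolutionOfSingularities.ResolutionOfSingularities.Theorems.HomologicalConductor.CompletionAscentPunctured

end
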